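import Summits.PneNP.PneNP.Theorems.SymmetryBudgetNoHiddenOrderBitValuationEnum

/-!
# `NoHiddenOrder` (stmt-PneNP-14781), (R2c) value layer I: the bit valuation and its root theorem

Route `PneNP/SymmetryBudget`; continues `SymmetryBudgetNoHiddenOrderBitValuationEnum.lean`.  `good_paste` (from
`paste_eq_bitEnc`), hence **`CGBits.bitValuation G n hn : CertifiedLabels.Valuation (cgProcess G) (BVal n)`** for
`Fintype.card V ≤ n`; and the ROOT THEOREM of the certified-label scheme with this valuation — `val_ne_none_of_reach`
(the valuation-generic completeness `CertifiedLabels.val_complete_replay` instantiated exactly as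
`BranchSum.cg_val_ne_none_of_reach_hgt`), `root_value` (the root group outputs a GOOD value of the start block, for any
admissibility predicate holding along the solution subtree of the heights) and `root_value_bitEnc` (at a well-formed start:
the encoding along an enumeration).  Sorry-free; supports stmt-PneNP-14781.
-/

set_option linter.dupNamespace false -- `Summit.PneNP.PneNP.…` (D-0017 single-conjunct layout)

namespace Summit.PneNP.PneNP.Theorems

open Finset BranchSum

namespace CGBits

variable {V : Type*} [DecidableEq V] {G : SimpleGraph V} [DecidableRel G.Adj] {n : ℕ}

/-! ### The valuation -/

/-- **(P1) good values of all parts paste to a good value.** [folklore] -/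
theorem good_paste [Fintype V] (hn : Fintype.card V ≤ n) (I : CGInst V) (ps : Finset (CGInst V)) (f : CGInst V → BVal n)
    (hs : cgStep G I = .andNode ps) (hf : ∀ J ∈ ps, Good G n J (f J)) : Good G n I (paste G n I f) := by
  classical
  obtain ⟨-, rfl⟩ := cgStep_eq_andNode_iff.1 hs
  by_cases hI : Wf n I
  · -- the parts' enumerations
    have hex : ∀ J, J ∈ cgParts G I → ∃ e, IsEnum n J.1.1 e ∧ f J = bitEnc G n I.1.2 J.1.1.card e := by
      intro J hJ
      obtain ⟨e, he, hfe⟩ := (good_iff_of_wf (wf_of_mem_cgParts hI hJ)).1 (hf J hJ)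
      exact ⟨e, he, (mem_cgParts_iff.1 hJ).1 ▸ hfe⟩
    let eJ : CGInst V → Fin n → V := fun J => if hJ : J ∈ cgParts G I then (hex J hJ).choose else fun _ => I.2.choose
    have hP : PartEnums G n I f eJ :=
      { isEnum := fun J hJ => by simp only [eJ, dif_pos hJ]; exact (hex J hJ).choose_spec.1
        eq := fun J hJ => by simp only [eJ, dif_pos hJ]; exact (hex J hJ).choose_spec.2 }
    exact (good_iff_of_wf hI).2 ⟨_, isEnum_pasteEnum hs hP hI hn, paste_eq_bitEnc hs hP hI⟩
  · rw [good_iff_of_not_wf hI]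
    unfold paste; rw [if_neg hI]

variable (G n) in
/-- **The BIT VALUATION of the components-only Corneil–Goldberg process**: bitvector values, `Good` = read along an
enumeration, leaves along `someEnum`, lifting bitwise through the refined classes, pasting by the rank/offset layout,
choice the lexicographic minimum. [folklore] -/
noncomputable def bitValuation [Fintype V] (hn : Fintype.card V ≤ n) : CertifiedLabels.Valuation (cgProcess G) (BVal n) where
  Good := Good G n
  leafVal := leafVal G n
  paste := paste G n
  lift := lift G n
  pick := pick n
  good_leaf I _ := good_leafVal hn I
  good_paste I ps f hs hf := good_paste hn I ps f hs hf
  good_lift I A ch x E hs _ hE := good_lift hn I A ch x E hs hE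
  pick_mem := pick_mem
  pick_ne_none := pick_ne_none

/-! ### The root theorem with the bit valuation -/

/-- **Completeness with heights as values** for the bit valuation (the valuation-generic `val_complete_replay`, instantiated
exactly as `cg_val_ne_none_of_reach_hgt`): along the solution subtree of the canonical selector with the heights as values,
every admissible group outputs a value. [folklore] -/
theorem val_ne_none_of_reach [Fintype V] (hn : Fintype.card V ≤ n) (adm : CertifiedLabels.Label V → Prop) (I₀ : CGInst V)
    (hadm : ∀ I X lam, CertifiedLabels.Reach (cgProcess G) (cgSel (V := V)) (hgt G cgSel) I₀ I X lam → adm ⟨I.1.1, X, lam⟩)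
    (I : CGInst V) (X : Finset V) (lam : V → ℕ)
    (h : CertifiedLabels.Reach (cgProcess G) (cgSel (V := V)) (hgt G cgSel) I₀ I X lam) :
    CertifiedLabels.val (cgProcess G) (bitValuation G n hn) (fun L => CertifiedLabels.replay (cgProcess G) L I₀ ∅) adm
      (Fintype.card V) ⟨I.1.1, X, lam⟩ ≠ none := by
  refine CertifiedLabels.val_complete_replay (bitValuation G n hn) adm _ (cgSel (V := V)) (hgt G cgSel) I₀ cgSel_mem
    (fun I _ _ _ => hgt_cgSel_lt_card I) (fun I A ch hs => ?_) (fun I X lam A ch hR hs => ?_) hadm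
    cgStep_parts_disjoint verts_nonempty (fun I X lam A ch _ hs β Xβ lamβ Aβ chβ hR _ hβA => ?_) I X lam h
  · obtain ⟨-, -, -, rfl⟩ := cgStep_eq_orNode_iff.1 hs
    rfl
  · exact cgSel_fresh cgSel_mem I X lam A ch hR hs
  · exact hgt_lt_of_reachFrom cgSel_mem I A ch hs hR hβA

/-- **The root group outputs a good value of the start block** (bit valuation, any admissibility predicate holding along the
solution subtree of the heights). [folklore] -/
theorem root_value [Fintype V] (hn : Fintype.card V ≤ n) (adm : CertifiedLabels.Label V → Prop) (I₀ : CGInst V)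
    (hadm : ∀ I X lam, CertifiedLabels.Reach (cgProcess G) (cgSel (V := V)) (hgt G cgSel) I₀ I X lam → adm ⟨I.1.1, X, lam⟩) :
    ∃ E, CertifiedLabels.val (cgProcess G) (bitValuation G n hn) (fun L => CertifiedLabels.replay (cgProcess G) L I₀ ∅) adm
        (Fintype.card V) ⟨I₀.1.1, ∅, fun _ => 0⟩ = some E ∧ Good G n I₀ E := by
  have hne := val_ne_none_of_reach hn adm I₀ hadm I₀ ∅ (fun _ => 0) CertifiedLabels.Reach.root
  obtain ⟨E, hE⟩ := Option.ne_none_iff_exists'.1 hne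
  refine ⟨E, hE, ?_⟩
  obtain ⟨I, hI, hgood⟩ := CertifiedLabels.val_sound (cgProcess G) (bitValuation G n hn) _ adm _ _ E hE
  rw [replay_root_label] at hI
  cases hI
  exact hgood

/-- **At a well-formed start block the root value is the encoding along an enumeration.** [folklore] -/
theorem root_value_bitEnc [Fintype V] (hn : Fintype.card V ≤ n) (adm : CertifiedLabels.Label V → Prop) (I₀ : CGInst V)
    (hI₀ : Wf n I₀)
    (hadm : ∀ I X lam, CertifiedLabels.Reach (cgProcess G) (cgSel (V := V)) (hgt G cgSel) I₀ I X lam → adm ⟨I.1.1, X, lam⟩) :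
    ∃ E, CertifiedLabels.val (cgProcess G) (bitValuation G n hn) (fun L => CertifiedLabels.replay (cgProcess G) L I₀ ∅) adm
        (Fintype.card V) ⟨I₀.1.1, ∅, fun _ => 0⟩ = some E ∧
      ∃ e, IsEnum n I₀.1.1 e ∧ E = bitEnc G n I₀.1.2 I₀.1.1.card e := by
  obtain ⟨E, hE, hgood⟩ := root_value hn adm I₀ hadm
  exact ⟨E, hE, (good_iff_of_wf hI₀).1 hgood⟩

end CGBits

end Summit.PneNP.PneNP.Theorems
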